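import Literature.Computability.QuantumComplexity.QFTBlockWord
import Literature.Computability.QuantumComplexity.QFTStageImplOn
import Literature.Computability.QuantumComplexity.CircuitEmbedding
import HarnessLib

/-!
# The Fourier stage of the quantum part: the block word transported to the `n` coefficient registers

Topic `Literature/Computability/QuantumComplexity`, sequel of `QFTBlockWord.lean` (the Fourier block: a
Clifford+`T` circuit on `qbsize κ k` wires implementing the `κ`-qubit QFT of its data wires on the kit's
clean-input condition) and `QFTStageImplOn.lean` (errors add over the blocks). Regev's Fourier stage
("apply the quantum Fourier transform on `ℤ_R^n`", Lemma 3.14) runs the block on each of the `n`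
coefficient registers; in the tree's model the block circuit is transported along wire embeddings
`E i : Fin (qbsize κ k) ↪ Fin W` with pairwise disjoint ranges (`CircuitEmbedding.mapWires`,
`toMatrix_mapWires = placeGate`):

* transported ideal gates: `placeGate_cphase`, `placeGate_hOn`, `allGates_trans`
  (`allGates (ws.trans ι) = (allGates ws).map (placeGate ι)`), and the transported steps `placeStep`;
* `QFTStage.P E` — the intersection of the pulled-back clean-input conditions, closed under rewriting
  every data wire (`update_mem_P_iff`); `QFTStage.stageCircuit` — the chain of the transported blocks;
* **`QFTStage.stageCircuit_implOn`** — the stage implements `multiQFT S`, `S i = dataEmb.trans (E i)`, on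
  `P E` up to `n · κ² · qftPhaseErr k`.

Everything here is proved; definitions have bodies; no named fact is introduced.

## References

* O. Regev, *On lattices, learning with errors, random linear codes, and cryptography*, J. ACM 56
  (2009), art. 34, Lemma 3.14 (proof) [Regev2009].
* M. A. Nielsen, I. L. Chuang, *Quantum Computation and Quantum Information*, CUP 2010, §4.2, §4.5.3,
  §5.1 [NielsenChuang2010].
-/

noncomputable section

namespace Literature.Computability.QuantumComplexity

open _root_.Matrix Finset Cryptography QFTQubits QFTWord

variable {N N' κ : ℕ}

/-! ### Transported ideal gates -/

/-- **A transported controlled phase is the controlled phase of the transported wires.** [cite: NielsenChuang2010, §4.2] -/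
theorem placeGate_cphase (ι : Fin N' ↪ Fin N) (ws : Fin κ ↪ Fin N') (j l : Fin κ) :
    placeGate ι (cphase ws j l) = cphase (ws.trans ι) j l := by
  unfold cphase
  rw [placeGate_diagonal]
  rfl

/-- **A transported Hadamard is the Hadamard of the transported wire.** [cite: NielsenChuang2010, §4.2] -/
theorem placeGate_hOn (ι : Fin N' ↪ Fin N) (w : Fin N') : placeGate ι ((hOn w).toMatrix 0) = (hOn (ι w)).toMatrix 0 := by
  rw [← toMatrix_mapWiresGate]
  have h : mapWiresGate ι (hOn w) = hOn (ι w) := by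
    unfold hOn mapWiresGate
    congr 1
  rw [h]

/-- **The transported gate list of the QFT is the gate list of the transported wires.** [cite: NielsenChuang2010, §5.1] -/
theorem allGates_trans (ι : Fin N' ↪ Fin N) (ws : Fin κ ↪ Fin N') :
    (allGates ws).map (placeGate ι) = allGates (ws.trans ι) := by
  rw [allGates, allGates, List.map_flatten, List.map_reverse, List.map_ofFn]
  congr 2
  refine List.ofFn_inj.2 (funext fun j => ?_)
  rw [Function.comp_apply, roundGates, roundGates, List.map_append, List.map_ofFn, List.map_singleton, placeGate_hOn]
  congr 1
  · exact List.ofFn_inj.2 (funext fun l => placeGate_cphase ι ws j l)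

/-- **A transported step.** [folklore] -/
def placeStep (ι : Fin N' ↪ Fin N) (s : ApproxStep N') : ApproxStep N := ⟨placeGate ι s.act, placeGate ι s.ideal, s.err⟩

/-! ### The stage over `n` blocks -/

namespace QFTStage

variable {n k W : ℕ} (E : Fin n → (Fin (QFTKit.qbsize κ k) ↪ Fin W))

/-- **The coefficient registers**: the data wires of the blocks. [cite: Regev2009, Lemma 3.14] -/
def S (i : Fin n) : Fin κ ↪ Fin W := (QFTKit.dataEmb κ k).trans (E i)

/-- **The clean-input condition of the stage**: every block's kit condition, pulled back. [folklore] -/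
def P : Set (QReg W) := ⋂ i, {x | x ∘ E i ∈ (QFTKit.kit κ k).P}

variable (hk1 : 1 ≤ k)

/-- The phase wires of the block are well placed in its kit. [folklore] -/
theorem wiresOK : WiresOK (QFTKit.kit κ k) (QFTKit.dataEmb κ k) where
  lt j := (QFTKit.data_facts κ k j).1
  d0 j := (QFTKit.data_facts κ k j).2.1
  had j := (QFTKit.data_facts κ k j).2.2.1
  hs j := (QFTKit.data_facts κ k j).2.2.2

/-- The programs of the block are dominated by its kit. [folklore] -/
theorem progOK (j l : Fin κ) (hjl : j < l) : ProgOK (QFTKit.kit κ k) j l := by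
  have hm : mOf j l ≤ κ := by unfold mOf; have := l.2; omega
  obtain ⟨h1, h2, h3⟩ := QFTKit.q_bounds κ k hm
  exact ⟨h1, h2, h3⟩

/-- **The Fourier block of the stage** (the circuit of `QFTBlockWord` for the concrete kit). [folklore] -/
def block : QCircuit cliffordT (QFTKit.qbsize κ k) :=
  blockCircuit (QFTKit.kit_ok κ k hk1) (wiresOK (κ := κ) (k := k)) (fun j l h => progOK j l h)

/-- Its steps. [folklore] -/
def steps : List (ApproxStep (QFTKit.qbsize κ k)) :=
  blockSteps (QFTKit.kit_ok κ k hk1) (wiresOK (κ := κ) (k := k)) (fun j l h => progOK j l h)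

/-- **The stage circuit**: the block transported to every register (block `0` applied first). [cite: Regev2009, Lemma 3.14 (proof)] -/
def stageCircuit : QCircuit cliffordT W := chainCircuit ((List.ofFn fun i => mapWires (E i) (block (κ := κ) hk1)).reverse)

variable {E}

include hk1 in
/-- **The stage's condition ignores the data wires** (disjoint blocks). [folklore] -/
theorem update_mem_P_iff (hE : BlockDisjoint E) (i : Fin n) (j : Fin κ) (x : QReg W) (b : Bool) :
    Function.update x (S E i j) b ∈ P E ↔ x ∈ P E := by
  unfold P
  simp only [Set.mem_iInter, Set.mem_setOf_eq]
  refine forall_congr' fun i' => ?_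
  by_cases hii : i' = i
  · subst hii
    rw [S, Function.Embedding.trans_apply, update_comp_emb]
    exact QFTWord.update_mem_P_iff (QFTKit.kit_ok κ k hk1) wiresOK j (x ∘ E i') b
  · have hnot : S E i j ∉ Set.range (E i') := fun hr =>
      Set.disjoint_left.1 (hE i i' (Ne.symm hii)) ⟨QFTKit.dataEmb κ k j, rfl⟩ hr
    rw [Function.update_comp_eq_of_notMem_range _ _ hnot]

/-- **The Fourier stage implements the `n`-fold QFT** on `P E` up to `n · κ² · qftPhaseErr k`
(pairwise disjoint blocks, `k ≥ 1`). [cite: Regev2009, Lemma 3.14 (proof)] [cite: NielsenChuang2010, §4.5.3 and §5.1] -/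
theorem stageCircuit_implOn (hE : BlockDisjoint E) :
    ImplOn (P E) ((stageCircuit E hk1).toMatrix 0) (multiQFT (S E)) (n * (κ * κ * qftPhaseErr k)) := by
  have hkOK := QFTKit.kit_ok κ k hk1
  set L : Fin n → List (ApproxStep W) := fun i => (steps (κ := κ) hk1).map (placeStep (E i)) with hL
  -- the ideal gates
  have hideal : ∀ i, (L i).map ApproxStep.ideal = allGates (S E i) := by
    intro i
    rw [hL]
    simp only [List.map_map]
    rw [show (ApproxStep.ideal ∘ placeStep (E i)) = (placeGate (E i) ∘ ApproxStep.ideal) from rfl, ← List.map_map,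
      steps, blockSteps_map_ideal, allGates_trans]
    rfl
  -- each step
  have hgood := blockSteps_good hkOK (wiresOK (κ := κ) (k := k)) (fun j l h => progOK j l h) hk1
  have himpl : ∀ i, ∀ s ∈ L i, ImplOn (P E) s.act s.ideal s.err := by
    intro i s hs
    rw [hL, List.mem_map] at hs
    obtain ⟨s₀, hs₀, rfl⟩ := hs
    obtain ⟨h1, -, h3⟩ := hgood s₀ hs₀
    exact (ImplOn.placeGate (E i) h1 h3).of_subset fun x hx => Set.mem_iInter.1 hx i
  have hcontr : ∀ i, ∀ s ∈ L i, IsContraction s.act := by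
    intro i s hs
    rw [hL, List.mem_map] at hs
    obtain ⟨s₀, hs₀, rfl⟩ := hs
    exact (hgood s₀ hs₀).2.1.placeGate (E i)
  have herr : ∀ i, ∀ s ∈ L i, 0 ≤ s.err := by
    intro i s hs
    rw [hL, List.mem_map] at hs
    obtain ⟨s₀, hs₀, rfl⟩ := hs
    exact (hgood s₀ hs₀).2.2
  have h := implOn_multiQFT_of_blocks (S E) (fun i j x b => update_mem_P_iff hk1 hE i j x b) L hideal himpl hcontr herr
  -- the actual product is the stage circuit
  have hact : (((List.ofFn L).reverse.flatten).map ApproxStep.act).prod = (stageCircuit E hk1).toMatrix 0 := by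
    have e1 : ∀ i, ((L i).map ApproxStep.act).prod = placeGate (E i) ((block (κ := κ) hk1).toMatrix 0) := by
      intro i
      rw [hL]
      dsimp only
      rw [List.map_map, show (ApproxStep.act ∘ placeStep (E i)) = (placeGate (E i) ∘ ApproxStep.act) from rfl, ← List.map_map,
        ← placeGate_listProd]
      congr 1
      exact (toMatrix_blockCircuit _ _ _).symm
    rw [stageCircuit, toMatrix_chainCircuit]
    simp only [List.map_flatten, List.prod_flatten, List.map_reverse, List.map_ofFn]
    congr 2
    refine List.ofFn_inj.2 (funext fun i => ?_)
    simp only [Function.comp_apply]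
    rw [e1 i, toMatrix_mapWires]
  -- the error
  have hsum : (((List.ofFn L).reverse.flatten).map ApproxStep.err).sum ≤ n * (κ * κ * qftPhaseErr k) := by
    have hone : ∀ i, ((L i).map ApproxStep.err).sum ≤ κ * κ * qftPhaseErr k := by
      intro i
      rw [hL]
      simp only [List.map_map]
      rw [show (ApproxStep.err ∘ placeStep (E i)) = ApproxStep.err from rfl]
      exact sum_err_blockSteps_le hkOK (wiresOK (κ := κ) (k := k)) (fun j l h => progOK j l h)
    simp only [List.map_flatten, List.sum_flatten, List.map_reverse, List.sum_reverse, List.map_ofFn, List.sum_ofFn, Function.comp_apply]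
    calc ∑ i : Fin n, ((L i).map ApproxStep.err).sum ≤ ∑ _i : Fin n, (κ : ℝ) * κ * qftPhaseErr k := sum_le_sum fun i _ => hone i
      _ = n * (κ * κ * qftPhaseErr k) := by rw [sum_const, card_univ, Fintype.card_fin, nsmul_eq_mul]
  rw [hact] at h
  exact h.mono hsum

end QFTStage

end Literature.Computability.QuantumComplexity

end
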